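import Summits.AtomisticToContinuum.Crystallization.Theorems.OverbindingBudgetAffineRunCutForgone

/-!
# `OverbindingBudget` / crux `RobustDefectLimitWindows` (stmt-AtomisticToContinuum-31280) — «RunCut»: CROSS-PATCH pairs under JOINT letter averaging

Support file (lens-4 g86, hand-in 3 part 0; answers the critic's standing check «C-XPATCH» of row 1534 for the competitor leaf **SW♭**
`StackSwapGainFlat(Wide)`; memo `g86/memo/SW-G1.md` §8).

THE DESIGN DECISION.  The competitor slips a SEPARATED family of patches; patch `π` is slipped by `c·w^π_α` with its OWN letter
`α = α(π) ∈ {1,2,3}` and its own slip frame `w^π_1 + w^π_2 + w^π_3 = 0`, `‖w^π_α‖² = σ_π`.  The letters are chosen JOINTLY: the total energy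
change is averaged over the PRODUCT of the uniform letter choices (independent across patches), and an assignment not worse than the average
exists.  Under the product average every pair sees at most two independent letters:
* mover–static and same-patch mover–mover pairs: the 3-average of `…RunCutForgone.avg_lennardJones_sub_le` (first order cancels, second
  order `≤ (23/10)·σ·‖x‖⁻⁸`);
* CROSS-PATCH mover–mover pairs (this file): the relative displacement is `t_α − t′_β` with `α, β` INDEPENDENT, so the pair is averaged over
  all NINE `(α, β)` — and the first order cancels AGAIN (`∑_{α,β} (t_α − t′_β) = 0`), while the second order at most doubles:
  ★ `avg9_lennardJones_sub_le`: `‖x‖² ≥ 300`, `578(σ + σ′) ≤ ‖x‖²` ⇒ `|(1/9)∑_{α,β} V(‖x − (t_α − t′_β)‖) − V(‖x‖)| ≤ (23/10)·(σ + σ′)·‖x‖⁻⁸`.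
  The two frames need not be related (different grains, different scales).
THE ALGEBRA (§1, `avg_ljSq_family`): the α-average core of file 6 restated for an arbitrary finite family of squared-distance increments
`ε_i = q_i − 2e_i` (`q_i = ‖d_i‖² ≤ 2S`, `e_i = ⟨x, d_i⟩`, `e_i² ≤ P q_i`) with `∑ q_i = |family|·S`, `∑ e_i = 0`, `∑ q_i e_i = 0`,
`∑ e_i² ≤ |family|·S·P/2`: `|∑_i (ljSq(P + ε_i) − ljSq P)| ≤ |family|·(23/10)·S·P⁻⁴`.  §2 checks the four moment identities for the nine
cross displacements (`∑ q = 9(σ+σ′)` and `∑ q e = 0` because `∑_β ⟨t_α, t′_β⟩ = ⟨t_α, ∑ t′⟩ = 0`; `∑ e² = 3∑⟨x,t_α⟩² + 3∑⟨x,t′_β⟩² ≤ (9/2)(σ+σ′)‖x‖²`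
by the 120°-frame Bessel inequality `inner_sq_sum_le` of file 6 applied to each frame).  §4 is the combinatorial half: over the
product of the letter choices a one-patch quantity averages to its 3-average (`three_mul_sum_letters`), a two-patch quantity to its 9-average
(`nine_mul_sum_letters`, via `Equiv.funSplitAt`), and an assignment not worse than the average exists (`exists_letters_le`).
[this file: 0 definitions, 8 theorems; standard axioms]
-/

noncomputable section

namespace Summit.AtomisticToContinuum.Crystallization.Theorems.OverbindingBudgetAffineRunCutCrossPatch

open Finset
open Literature.MathematicalPhysics.StatisticalMechanics (lennardJones)
open Summit.AtomisticToContinuum.Crystallization.Theorems.OverbindingBudgetAffineRunCutForgone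

-- `E3 = EuclideanSpace ℝ (Fin 3)`: the tree abbreviation (no file-local notation, per the landing-lane lint of critic row 1535)
open Summit.AtomisticToContinuum.Crystallization.Theorems.ChargedEnergyGapNegative (E3)

/-! ## §1. The averaged second-order bound for a finite family of displacements (real core) -/

/-- **Family core.** `P ≥ 300`, `0 ≤ S`, `578·S ≤ P`; increments `ε_i = q_i − 2e_i` with `0 ≤ q_i ≤ 2S`, `e_i² ≤ P·q_i`, and the four
moment conditions `∑ q_i = n·S`, `∑ e_i = 0`, `∑ q_i e_i = 0`, `∑ e_i² ≤ n·S·P/2` (`n` = size of the family)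
⇒ `|∑_i (ljSq(P + ε_i) − ljSq P)| ≤ n·(23/10)·S·P⁻⁴`. [this file · kind: proof] -/
theorem avg_ljSq_family {ι : Type*} (s : Finset ι) {P S : ℝ} (q e : ι → ℝ) (hP : 300 ≤ P) (hS : 0 ≤ S) (hSP : 578 * S ≤ P)
    (hq0 : ∀ i ∈ s, 0 ≤ q i) (hq2 : ∀ i ∈ s, q i ≤ 2 * S) (he : ∀ i ∈ s, e i ^ 2 ≤ P * q i)
    (m1 : ∑ i ∈ s, q i = s.card * S) (m2 : ∑ i ∈ s, e i = 0) (m3 : ∑ i ∈ s, q i * e i = 0)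
    (m4 : ∑ i ∈ s, e i ^ 2 ≤ s.card * S * P / 2) :
    |∑ i ∈ s, (ljSq (P + (q i - 2 * e i)) - ljSq P)| ≤ s.card * (23 / 10 * S * (P⁻¹) ^ 4) := by
  have hP0 : 0 < P := by linarith
  set u : ℝ := P⁻¹ with hu
  have hu0 : 0 < u := inv_pos.2 hP0
  have hPu : P * u = 1 := mul_inv_cancel₀ hP0.ne'
  have hn : (0 : ℝ) ≤ s.card := Nat.cast_nonneg _
  -- each increment is admissible for the sandwich: `8|ε_i| ≤ P`
  have h17 : 0 ≤ P / 17 := by positivity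
  have hsq : (P / 17) ^ 2 = P * (P / 289) := by ring
  have hb : ∀ i ∈ s, 8 * |q i - 2 * e i| ≤ P := by
    intro i hi
    have hqi : q i ≤ P / 289 := by linarith [hq2 i hi]
    have : |e i| ≤ P / 17 := abs_le_of_sq_le_sq (by rw [hsq]; nlinarith [he i hi, hq0 i hi]) h17
    have h' : |q i - 2 * e i| ≤ |q i| + 2 * |e i| := by
      calc |q i - 2 * e i| ≤ |q i| + |2 * e i| := abs_sub (q i) (2 * e i)
        _ = |q i| + 2 * |e i| := by rw [abs_mul, abs_two]
    rw [abs_of_nonneg (hq0 i hi)] at h'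
    linarith
  -- sum the per-increment sandwiches
  have lo : ∀ i ∈ s, 1 / 2 * (q i - 2 * e i) * u ^ 4 - 11 / 8 * (q i - 2 * e i) ^ 2 * u ^ 5
      - 1 / 2 * (q i - 2 * e i) * u ^ 7 - 6 * (q i - 2 * e i) ^ 2 * u ^ 8 ≤ ljSq (P + (q i - 2 * e i)) - ljSq P :=
    fun i hi => (ljSq_sandwich hP0 (hb i hi)).1
  have up : ∀ i ∈ s, ljSq (P + (q i - 2 * e i)) - ljSq P ≤ 1 / 2 * (q i - 2 * e i) * u ^ 4 - 5 / 8 * (q i - 2 * e i) ^ 2 * u ^ 5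
      - 1 / 2 * (q i - 2 * e i) * u ^ 7 + 6 * (q i - 2 * e i) ^ 2 * u ^ 8 :=
    fun i hi => (ljSq_sandwich hP0 (hb i hi)).2
  have hlo := sum_le_sum lo
  have hup := sum_le_sum up
  -- the first two moments of the increments
  set E1 : ℝ := ∑ i ∈ s, (q i - 2 * e i) with hE1
  set E2 : ℝ := ∑ i ∈ s, (q i - 2 * e i) ^ 2 with hE2
  have s1 : E1 = s.card * S := by
    rw [hE1, sum_sub_distrib, ← mul_sum, m1, m2]; ring
  have hQ2 : ∑ i ∈ s, q i ^ 2 ≤ 2 * S * (s.card * S) := by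
    rw [← m1, mul_sum]
    refine sum_le_sum fun i hi => ?_
    rw [sq]
    exact mul_le_mul_of_nonneg_right (hq2 i hi) (hq0 i hi)
  have s2 : E2 ≤ 2 * S * (s.card * S) + 4 * (s.card * S * P / 2) := by
    have hx : E2 = ∑ i ∈ s, q i ^ 2 - 4 * ∑ i ∈ s, q i * e i + 4 * ∑ i ∈ s, e i ^ 2 := by
      rw [hE2, mul_sum, mul_sum, ← sum_sub_distrib, ← sum_add_distrib]
      exact sum_congr rfl fun i _ => by ring
    rw [hx, m3]
    linarith
  have s2' : 0 ≤ E2 := sum_nonneg fun i _ => sq_nonneg _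
  -- the summed bounds are linear in `E1`, `E2`
  have eqlo : ∑ i ∈ s, (1 / 2 * (q i - 2 * e i) * u ^ 4 - 11 / 8 * (q i - 2 * e i) ^ 2 * u ^ 5
      - 1 / 2 * (q i - 2 * e i) * u ^ 7 - 6 * (q i - 2 * e i) ^ 2 * u ^ 8)
      = 1 / 2 * E1 * u ^ 4 - 11 / 8 * E2 * u ^ 5 - 1 / 2 * E1 * u ^ 7 - 6 * E2 * u ^ 8 := by
    rw [hE1, hE2]
    simp only [sum_sub_distrib, ← sum_mul, ← mul_sum]
  have equp : ∑ i ∈ s, (1 / 2 * (q i - 2 * e i) * u ^ 4 - 5 / 8 * (q i - 2 * e i) ^ 2 * u ^ 5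
      - 1 / 2 * (q i - 2 * e i) * u ^ 7 + 6 * (q i - 2 * e i) ^ 2 * u ^ 8)
      = 1 / 2 * E1 * u ^ 4 - 5 / 8 * E2 * u ^ 5 - 1 / 2 * E1 * u ^ 7 + 6 * E2 * u ^ 8 := by
    rw [hE1, hE2]
    simp only [sum_add_distrib, sum_sub_distrib, ← sum_mul, ← mul_sum]
  rw [eqlo] at hlo
  rw [equp] at hup
  -- small parameters: `S·u ≤ 1/578`, `u³ ≤ 1/27000000`
  have hSu : S * u ≤ 1 / 578 := by
    have := mul_le_mul_of_nonneg_right hSP hu0.le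
    rw [hPu] at this
    linarith
  have hu3 : u ^ 3 ≤ 1 / 27000000 := by
    have hu1 : u ≤ 1 / 300 := by
      rw [hu]; exact (inv_le_inv₀ hP0 (by norm_num)).2 hP |>.trans (by norm_num)
    calc u ^ 3 ≤ (1 / 300) ^ 3 := pow_le_pow_left₀ hu0.le hu1 3
      _ = 1 / 27000000 := by norm_num
  have f1 : S ^ 2 * u ^ 5 ≤ 1 / 578 * (S * u ^ 4) := by
    have := mul_le_mul_of_nonneg_right hSu (show 0 ≤ S * u ^ 4 by positivity)
    calc S ^ 2 * u ^ 5 = S * u * (S * u ^ 4) := by ring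
      _ ≤ _ := this
  have f2 : S * u ^ 7 ≤ 1 / 27000000 * (S * u ^ 4) := by
    have := mul_le_mul_of_nonneg_right hu3 (show 0 ≤ S * u ^ 4 by positivity)
    calc S * u ^ 7 = u ^ 3 * (S * u ^ 4) := by ring
      _ ≤ _ := this
  have f3 : S ^ 2 * u ^ 8 ≤ 1 / 578 * (S * u ^ 4) := by
    have hu1 : u ^ 3 ≤ 1 := hu3.trans (by norm_num)
    have := mul_le_mul_of_nonneg_right hu1 (show 0 ≤ S ^ 2 * u ^ 5 by positivity)
    calc S ^ 2 * u ^ 8 = u ^ 3 * (S ^ 2 * u ^ 5) := by ring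
      _ ≤ 1 * (S ^ 2 * u ^ 5) := this
      _ ≤ _ := by rw [one_mul]; exact f1
  have f0 : 0 ≤ S * u ^ 4 := by positivity
  -- `E2·u^5 ≤ n(2S²u⁵ + 2Su⁴)` and `E2·u^8 ≤ n(2S²u⁸ + 2Su⁷)` (`P·u = 1`)
  have g5 : E2 * u ^ 5 ≤ s.card * (2 * S ^ 2 * u ^ 5 + 2 * S * u ^ 4) := by
    have := mul_le_mul_of_nonneg_right s2 (pow_nonneg hu0.le 5)
    have e5 : (2 * S * (s.card * S) + 4 * (s.card * S * P / 2)) * u ^ 5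
        = s.card * (2 * S ^ 2 * u ^ 5 + 2 * S * u ^ 4 * (P * u)) := by ring
    rw [e5, hPu, mul_one] at this
    exact this
  have g8 : E2 * u ^ 8 ≤ s.card * (2 * S ^ 2 * u ^ 8 + 2 * S * u ^ 7) := by
    have := mul_le_mul_of_nonneg_right s2 (pow_nonneg hu0.le 8)
    have e8 : (2 * S * (s.card * S) + 4 * (s.card * S * P / 2)) * u ^ 8
        = s.card * (2 * S ^ 2 * u ^ 8 + 2 * S * u ^ 7 * (P * u)) := by ring
    rw [e8, hPu, mul_one] at this
    exact this
  have g5' : 0 ≤ E2 * u ^ 5 := by positivity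
  have g8' : 0 ≤ E2 * u ^ 8 := by positivity
  have k1 := mul_le_mul_of_nonneg_left f1 hn
  have k2 := mul_le_mul_of_nonneg_left f2 hn
  have k3 := mul_le_mul_of_nonneg_left f3 hn
  have k0 := mul_nonneg hn f0
  have k4 : 0 ≤ (s.card : ℝ) * (S * u ^ 7) := mul_nonneg hn (by positivity)
  rw [s1] at hlo hup
  rw [abs_le]
  constructor
  · linarith [hlo, g5, g8, k1, k2, k3, k0, k4]
  · linarith [hup, g8, g5', k1, k2, k3, k0, k4]

/-! ## §2. The nine cross displacements of two slip frames -/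

/-- Parallelogram bound: `‖v − w‖² ≤ 2‖v‖² + 2‖w‖²`. [folklore] -/
theorem norm_sub_sq_le_two (v w : E3) : ‖v - w‖ ^ 2 ≤ 2 * ‖v‖ ^ 2 + 2 * ‖w‖ ^ 2 := by
  have h := norm_add_sq_real v w
  have h' := norm_sub_sq_real v w
  nlinarith [norm_nonneg (v + w), sq_nonneg ‖v + w‖]

/-- **Moments of the nine cross displacements** `d_{αβ} = t_α − t′_β` of two frames (`∑ t = 0`, `‖t_α‖² = σ`; `∑ t′ = 0`, `‖t′_β‖² = σ′`):
`∑ ‖d‖² = 9(σ+σ′)`, `∑ ⟨x,d⟩ = 0`, `∑ ‖d‖²⟨x,d⟩ = 0`, `∑ ⟨x,d⟩² ≤ (9/2)(σ+σ′)‖x‖²`. [this file · kind: proof] -/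
theorem cross_moments (x : E3) (t t' : Fin 3 → E3) {σ σ' : ℝ} (h0 : t 0 + t 1 + t 2 = 0) (h1 : ∀ α, ‖t α‖ ^ 2 = σ)
    (h0' : t' 0 + t' 1 + t' 2 = 0) (h1' : ∀ β, ‖t' β‖ ^ 2 = σ') :
    (∑ p : Fin 3 × Fin 3, ‖t p.1 - t' p.2‖ ^ 2 = 9 * (σ + σ')) ∧
    (∑ p : Fin 3 × Fin 3, inner ℝ x (t p.1 - t' p.2) = 0) ∧
    (∑ p : Fin 3 × Fin 3, ‖t p.1 - t' p.2‖ ^ 2 * inner ℝ x (t p.1 - t' p.2) = 0) ∧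
    (∑ p : Fin 3 × Fin 3, inner ℝ x (t p.1 - t' p.2) ^ 2 ≤ 9 / 2 * (σ + σ') * ‖x‖ ^ 2) := by
  -- the frame relations
  have R : ∀ α, inner ℝ (t α) (t' 0) + inner ℝ (t α) (t' 1) + inner ℝ (t α) (t' 2) = 0 := fun α => by
    rw [← inner_add_right, ← inner_add_right, h0', inner_zero_right]
  have C : ∀ β, inner ℝ (t 0) (t' β) + inner ℝ (t 1) (t' β) + inner ℝ (t 2) (t' β) = 0 := fun β => by
    rw [← inner_add_left, ← inner_add_left, h0, inner_zero_left]
  have X : inner ℝ x (t 0) + inner ℝ x (t 1) + inner ℝ x (t 2) = 0 := by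
    rw [← inner_add_right, ← inner_add_right, h0, inner_zero_right]
  have X' : inner ℝ x (t' 0) + inner ℝ x (t' 1) + inner ℝ x (t' 2) = 0 := by
    rw [← inner_add_right, ← inner_add_right, h0', inner_zero_right]
  have A := inner_sq_sum_le x (t 0) (t 1) (t 2) h0 (h1 0) (h1 1) (h1 2)
  have B := inner_sq_sum_le x (t' 0) (t' 1) (t' 2) h0' (h1' 0) (h1' 1) (h1' 2)
  have nsq : ∀ α β, ‖t α - t' β‖ ^ 2 = σ + σ' - 2 * inner ℝ (t α) (t' β) := fun α β => by
    rw [norm_sub_sq_real, h1, h1']; ring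
  simp only [Fintype.sum_prod_type, Fin.sum_univ_three, inner_sub_right, nsq]
  have R0 := R 0; have R1 := R 1; have R2 := R 2
  have C0 := C 0; have C1 := C 1; have C2 := C 2
  refine ⟨by linarith, by linarith, ?_, ?_⟩
  · linear_combination (3 * (σ + σ')) * X - (3 * (σ + σ')) * X' - 2 * inner ℝ x (t 0) * R0 - 2 * inner ℝ x (t 1) * R1
      - 2 * inner ℝ x (t 2) * R2 + 2 * inner ℝ x (t' 0) * C0 + 2 * inner ℝ x (t' 1) * C1 + 2 * inner ℝ x (t' 2) * C2
  · nlinarith [A, B, X, X']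

/-! ## §3. The cross-patch pair bound -/

/-- ★ **THE (α, β)-AVERAGED CROSS-PATCH PAIR BOUND**: partner at relative position `x` with `‖x‖² ≥ 300`; two slip frames `t`, `t′`
(`∑ t = 0`, `‖t_α‖² = σ`; `∑ t′ = 0`, `‖t′_β‖² = σ′`) with `578(σ + σ′) ≤ ‖x‖²`:
`|(1/9)∑_{α,β} V(‖x − (t_α − t′_β)‖) − V(‖x‖)| ≤ (23/10)·(σ + σ′)·‖x‖⁻⁸` — the first order cancels under the joint average, the second-order
constant is that of `avg_lennardJones_sub_le` with `σ ↦ σ + σ′`. [this file · kind: proof] -/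
theorem avg9_lennardJones_sub_le (x : E3) (t t' : Fin 3 → E3) {σ σ' : ℝ} (h0 : t 0 + t 1 + t 2 = 0) (h1 : ∀ α, ‖t α‖ ^ 2 = σ)
    (h0' : t' 0 + t' 1 + t' 2 = 0) (h1' : ∀ β, ‖t' β‖ ^ 2 = σ') (hP : 300 ≤ ‖x‖ ^ 2) (hS : 578 * (σ + σ') ≤ ‖x‖ ^ 2) :
    |(∑ p : Fin 3 × Fin 3, lennardJones ‖x - (t p.1 - t' p.2)‖) / 9 - lennardJones ‖x‖|
      ≤ 23 / 10 * (σ + σ') * ((‖x‖ ^ 2)⁻¹) ^ 4 := by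
  have hσ : 0 ≤ σ := by rw [← h1 0]; positivity
  have hσ' : 0 ≤ σ' := by rw [← h1' 0]; positivity
  obtain ⟨m1, m2, m3, m4⟩ := cross_moments x t t' h0 h1 h0' h1'
  set q : Fin 3 × Fin 3 → ℝ := fun p => ‖t p.1 - t' p.2‖ ^ 2 with hq
  set e : Fin 3 × Fin 3 → ℝ := fun p => inner ℝ x (t p.1 - t' p.2) with he
  have d : ∀ p : Fin 3 × Fin 3, ‖x - (t p.1 - t' p.2)‖ ^ 2 = ‖x‖ ^ 2 + (q p - 2 * e p) := fun p => by
    rw [hq, he, norm_sub_sq_real]; ring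
  have hcore := avg_ljSq_family (Finset.univ : Finset (Fin 3 × Fin 3)) (P := ‖x‖ ^ 2) (S := σ + σ') q e hP (by positivity) hS
    (fun p _ => by rw [hq]; positivity)
    (fun p _ => by
      rw [hq]
      have := norm_sub_sq_le_two (t p.1) (t' p.2)
      rw [h1, h1'] at this
      linarith)
    (fun p _ => by
      rw [hq, he]
      have := real_inner_mul_inner_self_le x (t p.1 - t' p.2)
      rw [real_inner_self_eq_norm_sq, real_inner_self_eq_norm_sq] at this
      nlinarith [sq_nonneg (inner ℝ x (t p.1 - t' p.2))])
    (by rw [hq]; simp only [Finset.card_univ, Fintype.card_prod, Fintype.card_fin]; push_cast; linarith [m1])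
    m2 m3
    (by simp only [Finset.card_univ, Fintype.card_prod, Fintype.card_fin]; push_cast; linarith [m4])
  simp only [Finset.card_univ, Fintype.card_prod, Fintype.card_fin] at hcore
  push_cast at hcore
  have hsum : ∑ p : Fin 3 × Fin 3, lennardJones ‖x - (t p.1 - t' p.2)‖
      = ∑ p : Fin 3 × Fin 3, (ljSq (‖x‖ ^ 2 + (q p - 2 * e p)) - ljSq (‖x‖ ^ 2)) + 9 * ljSq (‖x‖ ^ 2) := by
    rw [Finset.sum_sub_distrib, Finset.sum_const, Finset.card_univ, Fintype.card_prod, Fintype.card_fin]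
    simp only [Nat.reduceMul, nsmul_eq_mul, Nat.cast_ofNat, sub_add_cancel]
    exact Finset.sum_congr rfl fun p _ => by rw [lennardJones_eq_ljSq, d p]
  rw [hsum, lennardJones_eq_ljSq]
  have e9 : (∑ p : Fin 3 × Fin 3, (ljSq (‖x‖ ^ 2 + (q p - 2 * e p)) - ljSq (‖x‖ ^ 2)) + 9 * ljSq (‖x‖ ^ 2)) / 9 - ljSq (‖x‖ ^ 2)
      = (∑ p : Fin 3 × Fin 3, (ljSq (‖x‖ ^ 2 + (q p - 2 * e p)) - ljSq (‖x‖ ^ 2))) / 9 := by ring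
  rw [e9, abs_div, abs_of_pos (by norm_num : (0:ℝ) < 9), div_le_iff₀ (by norm_num : (0:ℝ) < 9)]
  linarith [hcore]

/-! ## §4. Joint letter averaging: one- and two-patch marginals over the product of the letter choices -/

section Letters

variable {K : Type*} [Fintype K] [DecidableEq K]

/-- Splitting off one patch: `#(K → Fin 3) = 3 · #({j ≠ i} → Fin 3)`. [folklore] -/
theorem card_letters_split (i : K) : Fintype.card (K → Fin 3) = 3 * Fintype.card ({j // j ≠ i} → Fin 3) := by
  rw [Fintype.card_congr (Equiv.funSplitAt i (Fin 3)), Fintype.card_prod, Fintype.card_fin]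

/-- **One-patch marginal**: a quantity depending on the letter of patch `i` only averages over the product of all letter
choices to its plain 3-average: `3·∑_ℓ g(ℓ i) = #(K → Fin 3)·∑_a g a`. [folklore] -/
theorem three_mul_sum_letters (i : K) (g : Fin 3 → ℝ) :
    3 * ∑ ℓ : K → Fin 3, g (ℓ i) = Fintype.card (K → Fin 3) * ∑ a : Fin 3, g a := by
  have h1 : ∑ ℓ : K → Fin 3, g (ℓ i) = ∑ a : Fin 3, ∑ _r : {j // j ≠ i} → Fin 3, g a := by
    rw [Fintype.sum_equiv (Equiv.funSplitAt i (Fin 3)) (fun ℓ => g (ℓ i)) (fun x => g x.1) (fun ℓ => rfl),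
      Fintype.sum_prod_type]
  rw [h1, card_letters_split i]
  simp only [Finset.sum_const, Finset.card_univ, nsmul_eq_mul]
  rw [← Finset.mul_sum]
  push_cast
  ring

/-- **Two-patch marginal** (`j ≠ i`): a quantity depending on the letters of two distinct patches averages to its plain
9-average: `9·∑_ℓ g(ℓ i, ℓ j) = #(K → Fin 3)·∑_{(a,b)} g(a, b)` — the combinatorial half of the cross-patch bound (§3 is the
analytic half). [folklore] -/
theorem nine_mul_sum_letters {i j : K} (hij : j ≠ i) (g : Fin 3 → Fin 3 → ℝ) :
    9 * ∑ ℓ : K → Fin 3, g (ℓ i) (ℓ j) = Fintype.card (K → Fin 3) * ∑ p : Fin 3 × Fin 3, g p.1 p.2 := by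
  have h1 : ∑ ℓ : K → Fin 3, g (ℓ i) (ℓ j) = ∑ a : Fin 3, ∑ r : {k // k ≠ i} → Fin 3, g a (r ⟨j, hij⟩) := by
    rw [Fintype.sum_equiv (Equiv.funSplitAt i (Fin 3)) (fun ℓ => g (ℓ i) (ℓ j)) (fun x : Fin 3 × ({k // k ≠ i} → Fin 3) => g x.1 (x.2 ⟨j, hij⟩))
      (fun ℓ => rfl), Fintype.sum_prod_type]
  have h2 : ∀ a : Fin 3, 3 * ∑ r : {k // k ≠ i} → Fin 3, g a (r ⟨j, hij⟩)
      = Fintype.card ({k // k ≠ i} → Fin 3) * ∑ b : Fin 3, g a b := fun a =>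
    three_mul_sum_letters (K := {k // k ≠ i}) ⟨j, hij⟩ (g a)
  have h3 : ∑ a : Fin 3, 3 * ∑ r : {k // k ≠ i} → Fin 3, g a (r ⟨j, hij⟩)
      = ∑ a : Fin 3, (Fintype.card ({k // k ≠ i} → Fin 3) : ℝ) * ∑ b : Fin 3, g a b := Finset.sum_congr rfl fun a _ => h2 a
  rw [← Finset.mul_sum, ← Finset.mul_sum] at h3
  rw [h1, card_letters_split i, Fintype.sum_prod_type']
  push_cast
  linear_combination 3 * h3

/-- **A letter assignment not worse than the average exists.** [folklore] -/
theorem exists_letters_le {F : (K → Fin 3) → ℝ} {A : ℝ} (h : ∑ ℓ : K → Fin 3, F ℓ ≤ Fintype.card (K → Fin 3) * A) :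
    ∃ ℓ : K → Fin 3, F ℓ ≤ A := by
  have hne : (Finset.univ : Finset (K → Fin 3)).Nonempty := Finset.univ_nonempty
  have h' : ∑ ℓ ∈ (Finset.univ : Finset (K → Fin 3)), F ℓ ≤ ∑ ℓ ∈ (Finset.univ : Finset (K → Fin 3)), (fun _ => A) ℓ := by
    simpa [Finset.sum_const, Finset.card_univ, nsmul_eq_mul] using h
  obtain ⟨ℓ, -, hℓ⟩ := Finset.exists_le_of_sum_le hne h'
  exact ⟨ℓ, hℓ⟩

end Letters

end Summit.AtomisticToContinuum.Crystallization.Theorems.OverbindingBudgetAffineRunCutCrossPatch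

end
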